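import Summits.QuantumFields.YangMills.Theorems.BalabanUVNodesN09PerBondChartsOfInjectivityWindows
import Summits.QuantumFields.YangMills.Theorems.BalabanUVNodesN09CentralWindowInjective
import Literature.MathematicalPhysics.QuantumFieldTheory.Balaban1983to89.BlockAveragingCentralBlind

/-!
# NODE N09 [B12] — THE CENTRAL `α`-WINDOW AT THE RECORD: jointly measurable, blind to every private coordinate, and an injectivity window of the one-variable
# (0.4) average; hence the per-bond inversion data of the private-coordinate road to `hreg` FROM FORWARD JACOBIAN LAWS ALONE

Cell `pub-ymgap` (YM-PLAN Track A), width seat `pub-ymgap-dag-n09-w6` g3; helper of K1⁸ `StabilityBRunRowsAtRecordR13SepCoPH` = stmt-QuantumFields-26907 (`--supports`,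
`--as helper`, count-neutral).  [I] = [Balaban1987RG1].  CONSUMED BY NAME (all this seat unless said): `…N09PerBondChartsOfInjectivityWindows.exists_perBondCharts_of_injectivityWindows`
(Lusin–Souslin + inverse laws), `…N09CentralWindowInjective.avgFun_update_centralBond_injOn` (INTENT-6∕7: the contraction estimate read through n07-w2's normal form),
`BlockAveragingCentralBlind` (FACT (A) completed: `V_i`, `pre`, `post`, the guard are blind to every private coordinate), pub-balaban's `BlockAveragingEMLHaarAC.fibreFamily` ∕
`small_update_centralBond_self_iff` ∕ `coe_fibreFamily_of_not_isCentral`, `T4Continuum.measurable_holAt`, `RegularGaugeGroup.measurable_dist1`.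

THE WINDOW.  At level `j`, coarse bond `c`, environment `U`, radius `α`:  `Ωα c U := {g | ∀ i, dist1 (fibreFamily U c (pre U c · g · post U c) i) ≤ α}` — in words, every
loop variable of (0.4) at `c` of the configuration `U[β(c) ↦ g]` is within `α` of `1` (`loopHol_update_centralBond_self`).  For `α < δ_N` it lies inside the (0.4) guard.
§1 proves it is JOINTLY MEASURABLE in `(U, g)` (★ `measurableSet_centralWindow`), BLIND to resampling all private coordinates of `U` (★ `centralWindow_extend`), reads in matrix
form as INTENT-7's window (★ `mem_centralWindow_iff_matrix`), and is an INJECTIVITY WINDOW of `g ↦ Ū′(c)` when `α ≤ 1∕24`, `α < δ_N`, `offCard c∕|Idx| + 150·α < 1`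
(★★★ `avgFun_update_centralBond_injOn_centralWindow`); and that a configuration lies in its own window iff its loop variables at `c` are `α`-small (`self_mem_centralWindow_iff`).
§2 packages, at the record `avOfRecord F N K j` (`j < K`): from the FORWARD Jacobian laws of `g ↦ Ū′(c)` on these windows ALONE, the per-bond inversion data
`(Ω T ϑ jd; hΩm hTm hθm hjm hΩbl hright hlaw)` of `…N09HregOfPerBondChartsAtRecord.hreg_of_perBondCharts`, with the identification of `T` as the image window, the two-sided
inverse properties and the pointwise characterisation of `ϑ` a caller needs for the support clause and the fibre-integral continuity (★★★ `exists_perBondCharts_of_forwardLaws`).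
(Decidable equality of bonds is the tree's global instance `instDecidableEqPBond`, in scope through the N07 chain; no local `[DecidableEq]` binder — so that the `update` terms
of this file, of `…N09CentralWindowInjective` and of n07-w2's normal form carry one and the same instance.)

HONEST FRAMING.  Count-neutral kernel bookkeeping + the elementary contraction estimate of INTENT-6; NO Jacobian law proved (the forward law `hfwd` is a HYPOTHESIS — C¹-in-the-
exponential-chart of the (0.4) map ⇒ n09-w4 g4's `HaarExpChartChangeOfVariables.haar_restrict_image_eq_map_withDensity_jacobian`, the located successor piece), NO support clause,
NO continuity; nothing of Bałaban's asserted; `hreg` NOT discharged; N09 NOT discharged; conjunct 1 (Lemma 4) ∕ FLAG №7 untouched; K0⁷∕K1⁸ NOT closed; counts unmoved (typed 28∕28 ·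
discharged 5∕27); one finite four-torus programme at fixed `ε` — R4 closes the conditional rung `BalabanLadder.UV` only; NOT ℝ⁴ ∕ OS ∕ mass gap ∕ Clay.
-/

noncomputable section

open scoped Matrix.Norms.L2Operator

namespace Summit.QuantumFields.YangMills.BalabanUVNodes.N09CentralWindowAtRecord

open MeasureTheory Set Function
open scoped ENNReal NNReal
open Literature.MathematicalPhysics.QuantumFieldTheory.Balaban1983to89
open Literature.MathematicalPhysics.QuantumFieldTheory.Balaban1983to89.T4Continuum (T4Family measurable_holAt)
open Literature.MathematicalPhysics.QuantumFieldTheory.Balaban1983to89.BlockAveraging (Small Idx avgFun loopHol)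
open Literature.MathematicalPhysics.QuantumFieldTheory.Balaban1983to89.BlockAveragingHaarAC (centralBond pre post openHol IsCentral centralBond_injective)
open Literature.MathematicalPhysics.QuantumFieldTheory.Balaban1983to89.BlockAveragingEMLHaarAC
  (fibreFamily fibreFamily_of_isCentral fibreFamily_of_not_isCentral coe_fibreFamily_of_not_isCentral small_update_centralBond_self_iff loopHol_update_centralBond_self offCard)
open Literature.MathematicalPhysics.QuantumFieldTheory.Balaban1983to89.BlockAveragingCentralBlind
  (openHol_extend_centralBond pre_extend_centralBond post_extend_centralBond)
open Literature.MathematicalPhysics.QuantumFieldTheory.Balaban1983to89.ExpMeanLog (expMeanLogSU deltaSU)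
open Literature.MathematicalPhysics.QuantumFieldTheory.Balaban1983to89.Node00
open Summit.QuantumFields.YangMills.BalabanUVNodes.N09CentralWindowInjective (avgFun_update_centralBond_injOn)
open Summit.QuantumFields.YangMills.BalabanUVNodes.N09PerBondChartsOfInjectivityWindows (exists_perBondCharts_of_injectivityWindows)
open Summit.QuantumFields.YangMills.BalabanUVNodes.N09LiftInvariance29AtRecord (succ_le_range_of_lt)

variable {P : Params} {j : ℕ} {N : ℕ} [NeZero N]

/-! ## §1  The central `α`-window: measurability, blindness, matrix form, injectivity, self-membership -/

/-- ★ **THE CENTRAL `α`-WINDOW IS JOINTLY MEASURABLE** in the environment and the private coordinate (holonomies are measurable, `dist1` is measurable).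
[cite: Balaban1987RG1, (0.4) p.253 and (2.9) p.266 (bookkeeping)] -/
theorem measurableSet_centralWindow (c : PBond P (j + 1)) (α : ℝ) :
    MeasurableSet {p : GaugeField P j (SU N) × SU N | ∀ i : Idx P, dist1 (fibreFamily p.1 c (pre p.1 c * p.2 * post p.1 c) i) ≤ α} := by
  have hW : Measurable fun p : GaugeField P j (SU N) × SU N => pre p.1 c * p.2 * post p.1 c :=
    (((measurable_holAt _).comp measurable_fst).mul measurable_snd).mul ((measurable_holAt _).comp measurable_fst)
  have hfam : ∀ i : Idx P, Measurable fun p : GaugeField P j (SU N) × SU N => fibreFamily p.1 c (pre p.1 c * p.2 * post p.1 c) i := by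
    intro i
    by_cases hi : IsCentral c i
    · simp only [fibreFamily, if_pos hi]; exact measurable_const
    · simp only [fibreFamily, if_neg hi]
      exact ((measurable_holAt _).comp measurable_fst).mul hW.inv
  have hset : {p : GaugeField P j (SU N) × SU N | ∀ i : Idx P, dist1 (fibreFamily p.1 c (pre p.1 c * p.2 * post p.1 c) i) ≤ α} =
      ⋂ i, {p | dist1 (fibreFamily p.1 c (pre p.1 c * p.2 * post p.1 c) i) ≤ α} := by
    ext p; simp
  rw [hset]
  exact MeasurableSet.iInter fun i => measurableSet_le (RegularGaugeGroup.measurable_dist1.comp (hfam i)) measurable_const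

/-- ★ **THE CENTRAL `α`-WINDOW IS BLIND TO RESAMPLING ALL PRIVATE COORDINATES OF THE ENVIRONMENT** (`V_i` at off-central `i`, `pre`, `post` do not see them —
`BlockAveragingCentralBlind`; the central entries of the family are `1`). [cite: Balaban1987RG1, (0.4) p.253 (bookkeeping)] -/
theorem centralWindow_extend (hj : j + 1 ≤ P.m + P.K) (c : PBond P (j + 1)) (α : ℝ) (U : GaugeField P j (SU N)) (g' : PBond P (j + 1) → SU N) :
    {g : SU N | ∀ i : Idx P, dist1 (fibreFamily (extend centralBond g' U) c (pre (extend centralBond g' U) c * g * post (extend centralBond g' U) c) i) ≤ α} =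
      {g : SU N | ∀ i : Idx P, dist1 (fibreFamily U c (pre U c * g * post U c) i) ≤ α} := by
  ext g
  simp only [mem_setOf_eq]
  rw [pre_extend_centralBond hj, post_extend_centralBond hj]
  refine forall_congr' fun i => ?_
  by_cases hi : IsCentral c i
  · rw [fibreFamily_of_isCentral _ c _ i hi, fibreFamily_of_isCentral _ c _ i hi]
  · rw [fibreFamily_of_not_isCentral _ c _ i hi, fibreFamily_of_not_isCentral _ c _ i hi, openHol_extend_centralBond hj U c i hi]

/-- ★ **MATRIX FORM**: on the window, the (0.4) guard holds at `U[β(c) ↦ g]` as soon as `α < δ_N`, and the off-central conditions read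
`‖↑V_i·(↑pre·↑g·↑post)* − 1‖ ≤ α` (`dist1` on `SU(N)` IS the operator-norm distance, `rfl`). [cite: Balaban1987RG1, (0.4) p.253 and (2.9) p.266 (bookkeeping)] -/
theorem mem_injWindow_of_mem_centralWindow (hj : j + 1 ≤ P.m + P.K) (c : PBond P (j + 1)) {α : ℝ}
    (hαδ : α < deltaSU (Fin N)) (U : GaugeField P j (SU N)) {g : SU N} (hg : ∀ i : Idx P, dist1 (fibreFamily U c (pre U c * g * post U c) i) ≤ α) :
    Small (expMeanLogSU (n := Fin N)) (Function.update U (centralBond c) g) c ∧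
      ∀ i : Idx P, ¬ IsCentral c i →
        ‖((openHol U c i : SU N) : Matrix (Fin N) (Fin N) ℂ) *
            star (((pre U c : SU N) : Matrix (Fin N) (Fin N) ℂ) * (g : Matrix (Fin N) (Fin N) ℂ) * ((post U c : SU N) : Matrix (Fin N) (Fin N) ℂ)) - 1‖ ≤ α := by
  refine ⟨(small_update_centralBond_self_iff hj _ U c g).2 fun i => (hg i).trans_lt hαδ, fun i hi => ?_⟩
  have h := hg i
  rw [dist1_su_eq_norm, coe_fibreFamily_of_not_isCentral U c _ i hi, Submonoid.coe_mul, Submonoid.coe_mul] at h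
  exact h

/-- ★★★ **THE CENTRAL `α`-WINDOW IS AN INJECTIVITY WINDOW OF THE ONE-VARIABLE (0.4) AVERAGE** (`α ≤ 1∕24`, `α < δ_N`, `offCard c∕|Idx P| + 150·α < 1`).
[cite: Balaban1987RG1, (0.4) p.253 and p.267] -/
theorem avgFun_update_centralBond_injOn_centralWindow (hj : j + 1 ≤ P.m + P.K) (U : GaugeField P j (SU N)) (c : PBond P (j + 1))
    {α : ℝ} (hα0 : 0 ≤ α) (hα : α ≤ 1 / 24) (hαδ : α < deltaSU (Fin N)) (hgap : (offCard c : ℝ) / (Fintype.card (Idx P) : ℝ) + 150 * α < 1) :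
    InjOn (fun g : SU N => avgFun (expMeanLogSU (n := Fin N)) (Function.update U (centralBond c) g) c)
      {g : SU N | ∀ i : Idx P, dist1 (fibreFamily U c (pre U c * g * post U c) i) ≤ α} :=
  fun _ hg₁ _ hg₂ heq =>
    avgFun_update_centralBond_injOn hj U c hα0 hα hgap (mem_injWindow_of_mem_centralWindow hj c hαδ U hg₁)
      (mem_injWindow_of_mem_centralWindow hj c hαδ U hg₂) heq

/-- **A CONFIGURATION LIES IN ITS OWN WINDOW iff its loop variables at `c` are `α`-small** (the W-coordinate family at `W = pre·U(β(c))·post = U(c)` IS the loop family).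
[cite: Balaban1987RG1, (0.4) p.253 and (2.9) p.266 (bookkeeping)] -/
theorem self_mem_centralWindow_iff (hj : j + 1 ≤ P.m + P.K) (U : GaugeField P j (SU N)) (c : PBond P (j + 1)) (α : ℝ) :
    U (centralBond c) ∈ {g : SU N | ∀ i : Idx P, dist1 (fibreFamily U c (pre U c * g * post U c) i) ≤ α} ↔ ∀ i : Idx P, dist1 (loopHol U c i) ≤ α := by
  have h := loopHol_update_centralBond_self hj U c (U (centralBond c))
  rw [Function.update_eq_self] at h
  simp only [mem_setOf_eq, ← h]

/-! ## §2  At the record: the per-bond inversion data of the private-coordinate road to `hreg` from forward Jacobian laws on the central windows alone -/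

variable {F : T4Family}

/-- ★★★ **PER-BOND INVERSION DATA AT THE RECORD FROM FORWARD JACOBIAN LAWS ON THE CENTRAL WINDOWS ALONE** (one level `j < K`).  Fix `0 ≤ α ≤ 1∕24`, `α < δ_N`, with
`offCard c∕|Idx| + 150·α < 1` for every coarse bond `c`.  If, for every `c` and environment `U`, the FORWARD change-of-variables law of one-bond Haar measure under
`g ↦ Ū′(c)` holds on the central `α`-window `Ωα c U` with a jointly measurable density `jac_c(U,·)` non-vanishing there, THEN there are `T ϑ jd` with: `Ωα` and `T` jointly
measurable, `Ωα` blind to resampling all private coordinates, `ϑ`, `jd` jointly measurable, `Ū′(c)(ϑ_c(U,v)) = v` on `T_c(U)`, the INVERSE law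
`dg⌊Ωα_c(U) = ϑ_c(U,·)_*(jd_c(U,·)·dv⌊T_c(U))`, `T_c(U) =` the image window, `ϑ` a left inverse on `Ωα` with values in `Ωα` on `T` — i.e. every per-bond hypothesis of
`…N09HregOfPerBondChartsAtRecord.hreg_of_perBondCharts` at level `j` EXCEPT the support clause and the continuity, which stay the caller's.
[cite: Kechris1995, Thm 15.1 and Cor 15.2; Balaban1987RG1, p.259, (0.4) p.253, (2.9)–(2.10) pp.266–267] -/
theorem exists_perBondCharts_of_forwardLaws {K : ℕ} (hj : j < K) {α : ℝ} (hα0 : 0 ≤ α) (hα : α ≤ 1 / 24)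
    (hαδ : α < deltaSU (Fin N)) (hgap : ∀ c : PBond (F.P K) (j + 1), (offCard c : ℝ) / (Fintype.card (Idx (F.P K)) : ℝ) + 150 * α < 1)
    (jac : PBond (F.P K) (j + 1) → GaugeField (F.P K) j (SU N) → SU N → ℝ≥0)
    (hjacm : ∀ c, Measurable fun p : GaugeField (F.P K) j (SU N) × SU N => jac c p.1 p.2)
    (hjac0 : ∀ c U g, (∀ i : Idx (F.P K), dist1 (fibreFamily U c (pre U c * g * post U c) i) ≤ α) → jac c U g ≠ 0)
    (hfwd : ∀ c U, (HaarData.haar : Measure (SU N)).restrict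
        ((fun g => (avOfRecord F N K j).avg (Function.update U (centralBond c) g) c) ''
          {g : SU N | ∀ i : Idx (F.P K), dist1 (fibreFamily U c (pre U c * g * post U c) i) ≤ α}) =
      (((HaarData.haar : Measure (SU N)).restrict {g : SU N | ∀ i : Idx (F.P K), dist1 (fibreFamily U c (pre U c * g * post U c) i) ≤ α}).withDensity
          fun g => (jac c U g : ℝ≥0∞)).map (fun g => (avOfRecord F N K j).avg (Function.update U (centralBond c) g) c)) :
    ∃ (T : PBond (F.P K) (j + 1) → GaugeField (F.P K) j (SU N) → Set (SU N))
      (ϑ : PBond (F.P K) (j + 1) → GaugeField (F.P K) j (SU N) → SU N → SU N)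
      (jd : PBond (F.P K) (j + 1) → GaugeField (F.P K) j (SU N) → SU N → ℝ≥0),
      (∀ c, MeasurableSet {p : GaugeField (F.P K) j (SU N) × SU N | p.2 ∈
          {g : SU N | ∀ i : Idx (F.P K), dist1 (fibreFamily p.1 c (pre p.1 c * g * post p.1 c) i) ≤ α}}) ∧
      (∀ c (U : GaugeField (F.P K) j (SU N)) (g' : PBond (F.P K) (j + 1) → SU N),
          {g : SU N | ∀ i : Idx (F.P K), dist1 (fibreFamily (extend centralBond g' U) c
              (pre (extend centralBond g' U) c * g * post (extend centralBond g' U) c) i) ≤ α} =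
            {g : SU N | ∀ i : Idx (F.P K), dist1 (fibreFamily U c (pre U c * g * post U c) i) ≤ α}) ∧
      (∀ c, MeasurableSet {p : GaugeField (F.P K) j (SU N) × SU N | p.2 ∈ T c p.1}) ∧
      (∀ c, Measurable fun p : GaugeField (F.P K) j (SU N) × SU N => ϑ c p.1 p.2) ∧
      (∀ c, Measurable fun p : GaugeField (F.P K) j (SU N) × SU N => jd c p.1 p.2) ∧
      (∀ c U, ∀ v ∈ T c U, (avOfRecord F N K j).avg (Function.update U (centralBond c) (ϑ c U v)) c = v) ∧
      (∀ c U, (HaarData.haar : Measure (SU N)).restrict {g : SU N | ∀ i : Idx (F.P K), dist1 (fibreFamily U c (pre U c * g * post U c) i) ≤ α} =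
        (((HaarData.haar : Measure (SU N)).restrict (T c U)).withDensity fun v => (jd c U v : ℝ≥0∞)).map (ϑ c U)) ∧
      (∀ c U, T c U = (fun g => (avOfRecord F N K j).avg (Function.update U (centralBond c) g) c) ''
          {g : SU N | ∀ i : Idx (F.P K), dist1 (fibreFamily U c (pre U c * g * post U c) i) ≤ α}) ∧
      (∀ c U g, (∀ i : Idx (F.P K), dist1 (fibreFamily U c (pre U c * g * post U c) i) ≤ α) →
          ϑ c U ((avOfRecord F N K j).avg (Function.update U (centralBond c) g) c) = g) ∧
      (∀ c U, ∀ v ∈ T c U, ∀ i : Idx (F.P K), dist1 (fibreFamily U c (pre U c * ϑ c U v * post U c) i) ≤ α) := by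
  have hmeas : ∀ c : PBond (F.P K) (j + 1), MeasurableSet {p : GaugeField (F.P K) j (SU N) × SU N |
      p.2 ∈ {g : SU N | ∀ i : Idx (F.P K), dist1 (fibreFamily p.1 c (pre p.1 c * g * post p.1 c) i) ≤ α}} :=
    fun c => measurableSet_centralWindow c α
  have hinj : ∀ (c : PBond (F.P K) (j + 1)) (U : GaugeField (F.P K) j (SU N)),
      InjOn (fun g => (avOfRecord F N K j).avg (Function.update U (centralBond c) g) c)
        {g : SU N | ∀ i : Idx (F.P K), dist1 (fibreFamily U c (pre U c * g * post U c) i) ≤ α} :=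
    fun c U => avgFun_update_centralBond_injOn_centralWindow (succ_le_range_of_lt hj) U c hα0 hα hαδ (hgap c)
  obtain ⟨T, ϑ, jd, h1, h2, h3, h4, h5, h6, h7, h8⟩ := exists_perBondCharts_of_injectivityWindows (F := F) (N := N)
    (fun c U => {g : SU N | ∀ i : Idx (F.P K), dist1 (fibreFamily U c (pre U c * g * post U c) i) ≤ α}) hmeas hinj jac hjacm
    (fun c U g hg => hjac0 c U g hg) hfwd
  exact ⟨T, ϑ, jd, hmeas, fun c U g' => centralWindow_extend (succ_le_range_of_lt hj) c α U g', h1, h2, h3, h4, h5, h6, h7, h8⟩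

end Summit.QuantumFields.YangMills.BalabanUVNodes.N09CentralWindowAtRecord

end
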